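import Literature.NumberTheory.EllipticCurves.ComplexMultiplicationSingularModuliProofs
import Literature.NumberTheory.EllipticCurves.ComplexMultiplicationSingularModuliNonmaximal
import Literature.NumberTheory.EllipticCurves.SingularModuliIntegral
import Literature.NumberTheory.EllipticCurves.ModularPolynomialDegY
import Literature.NumberTheory.EllipticCurves.ComplexMultiplicationClassPolynomialRootProofs
import Literature.NumberTheory.EllipticCurves.SingularModuliCubeSquareAwayFromSix
import HarnessLib

/-!
# The modular equation of level 2, explicitly:
# `Φ₂(X, Y) = X³ + Y³ − X²Y² + 1488(X²Y + XY²) − 162000(X² + Y²) + 40773375XY + 8748000000(X + Y) − 157464000000000`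

Topic `NumberTheory/EllipticCurves` (complex multiplication).  Theorem-only file (no definition, no
named fact): the tree's integer modular equation `intModularPolynomial ℓ ∈ ℤ[Y][X]`
(`ModularPolynomialIntegral.lean`; characterised by `Φ_ℓ(X, j(τ)) = ∏_{σ ∈ C(ℓ)} (X − j(στ))`, Cox,
*Primes of the form x² + ny²*, 2nd ed., §11.B (11.14)–(11.15), §11.C Thm. 11.18) is identified at
`ℓ = 2` with the classical polynomial

  `Φ₂(X, Y) = X³ + Y³ − X²Y² + 1488 (X²Y + XY²) − 162000 (X² + Y²) + 40773375 XY`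
  `            + 8748000000 (X + Y) − 157464000000000`

(printed with `Φ₂(j(z), j(2z)) = 0` in Pila, *Point-Counting and the Zilber–Pink Conjecture* (2022),
p. 28, and classically in Fricke, *Die elliptischen Funktionen und ihre Anwendungen* II, 4. Kap.
"Transformationsgleichungen erster Stufe für niedere Grade n", p. 372 (2011 Springer ed., PDF p. 447);
its diagonal `Φ₂(X, X) = −(X − 8000)(X − 1728)(X + 3375)²` is Cox's Prop. 13.11, case `m = 2`:
`Φ_{2,1}(X, X) = H_{−4}(X) H_{−8}(X)`).

## Method: interpolation at CM points (no `q`-expansions)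

By the tree's shape theorems — `Φ₂` is monic of degree `3` in `X`
(`coeff_intModularPolynomial_natDegree_succ`), the coefficient of `X²Y²` is `−1`
(`coeff_coeff_intModularPolynomial_self`), `deg_Y(coeff of X^m) ≤ 2` for `m ≥ 1`
(`natDegree_coeff_intModularPolynomial_le_of_pos`) and `≤ 3` for `m = 0`
(`natDegree_coeff_intModularPolynomial_le`) — only NINE integer coefficients are unknown.  The fibre
identity `Φ₂(x, j(τ)) = (x − j(2τ))(x − j(τ/2))(x − j((τ+1)/2))` (`eval_map_kleinJ_modularPolynomial`)
at the three CM points `τ_{(1,1,1)}, τ_{(1,0,1)} = i, τ_{(1,1,2)}` — whose three level-2 conjugates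
are again CM points of CLASS NUMBER ONE (discriminants `−12`; `−16, −16, −4`; `−28, −7, −7`), so that
all nine values are the integers of Cox's table (12.20) / §12 (`54000`; `287496, 287496, 1728`;
`16581375, −3375, −3375`; tree: `formJ_principalForm` with the discharged table facts
`singularModuli_classNumberOne_holds`, `singularModuli_nonmaximalOrders_holds`) — together with the
diagonal root `Φ₂(8000, 8000) = 0` (`τ_{(1,0,2)} = i√2`: `j(τ/2) = j(τ)`), give ten linear equations
of rank nine whose unique solution is the classical coefficient vector.  The level-2 CM points are
moved to reduced forms by `mulPoint_two_heegnerTau`, `divPoint_two(_zero)_heegnerTau`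
(`SingularModuliWeberSquareRootInert.lean`), `formJ_eq_formJ_act` (Cox Thm. 11.2 / Ex. 11.5) and
`formJ_one_eq_of_discr_eq`.

## Main statements

* `intModularPolynomial_two` — the identity in `ℤ[Y][X]`;
* `intModularPolynomial_two_eval` — `Φ₂(x, y)` as the explicit complex polynomial expression, for
  all `x y : ℂ`;
* `modularEquation_two_kleinJ` — `Φ₂(j(2τ), j(τ)) = 0` written out explicitly, for every `τ ∈ ℍ`.

## References

* D. A. Cox, *Primes of the form x² + ny²*, 2nd ed. (2013), §11.B (11.14)–(11.15), §11.C Thm. 11.18,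
  §13.A Prop. 13.11.
* J. Pila, *Point-Counting and the Zilber–Pink Conjecture*, Cambridge Tracts in Math. 228 (2022), p. 28
  (the display `Φ₂(X, Y) = X³ − X²Y² + Y³ + 1488X²Y + … − 157464000000000`, `Φ₂(j(z), j(2z)) = 0`).
* R. Fricke, *Die elliptischen Funktionen und ihre Anwendungen*, Zweiter Teil (1922; Springer 2011),
  II.4 §1, p. 372.
-/

noncomputable section

open Complex Polynomial
open UpperHalfPlane hiding I
open scoped MatrixGroups

namespace Literature.NumberTheory.EllipticCurves

open ModularForms
open Literature.NumberTheory.QuadraticFields.Quadratic (BinQF)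
open Literature.NumberTheory.QuadraticFields.BinaryQuadraticForm (principalForm classNumberOneDiscrs)

namespace ModularPolynomialTwo

/-! ### The shape of `Φ₂ ∈ ℤ[Y][X]`: nine unknown coefficients -/

/-- `Φ₂` has degree `3` in `X`. [cite: Cox2013, §11.B after (11.15)] -/
theorem natDegree_eq : (intModularPolynomial 2).natDegree = 3 := natDegree_intModularPolynomial 2

/-- The coefficient of `X³` is `1`. [cite: Cox2013, §11.B after (11.15)] -/
theorem coeff_three : (intModularPolynomial 2).coeff 3 = 1 :=
  coeff_intModularPolynomial_natDegree_succ 2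

/-- Every coefficient of `Φ₂` has degree `≤ 3` in `Y`. [cite: Cox2013, §11.C Thm. 11.18(iii)] -/
theorem natDegree_coeff_le (m : ℕ) : ((intModularPolynomial 2).coeff m).natDegree ≤ 3 :=
  natDegree_coeff_intModularPolynomial_le 2 m

/-- The coefficients of `X¹`, `X²` have degree `≤ 2` in `Y`. [cite: Cox2013, §11.C Thm. 11.18(iii)] -/
theorem natDegree_coeff_le_two {m : ℕ} (hm : 1 ≤ m) : ((intModularPolynomial 2).coeff m).natDegree ≤ 2 :=
  natDegree_coeff_intModularPolynomial_le_of_pos 2 hm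

/-- The coefficient of `X²Y²` is `−1`. [cite: Cox2013, §11.C Thm. 11.18(iv)] -/
theorem coeff_two_two : ((intModularPolynomial 2).coeff 2).coeff 2 = -1 :=
  coeff_coeff_intModularPolynomial_self 2

/-- The coefficient of `X²Y³` vanishes. [cite: Cox2013, §11.C Thm. 11.18(iii)] -/
theorem coeff_two_three : ((intModularPolynomial 2).coeff 2).coeff 3 = 0 :=
  coeff_eq_zero_of_natDegree_lt (lt_of_le_of_lt (natDegree_coeff_le_two (by norm_num)) (by norm_num))

/-- The coefficient of `XY³` vanishes. [cite: Cox2013, §11.C Thm. 11.18(iii)] -/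
theorem coeff_one_three : ((intModularPolynomial 2).coeff 1).coeff 3 = 0 :=
  coeff_eq_zero_of_natDegree_lt (lt_of_le_of_lt (natDegree_coeff_le_two (by norm_num)) (by norm_num))

/-- The coefficient of `X³` is the constant `1`: its `Y`-coefficients. [cite: Cox2013, §11.B after (11.15)] -/
theorem coeff_three_coeff (i : ℕ) :
    ((intModularPolynomial 2).coeff 3).coeff i = if i = 0 then 1 else 0 := by
  rw [coeff_three, coeff_one]

/-! ### `Φ₂(x, y)` over `ℂ` as an explicit cubic in `x` with the nine unknown coefficients -/

/-- `Φ₂(x, y) = Σ_{m<4} (Σ_{i<4} κ_{m,i} yⁱ) x^m` over `ℂ`. [cite: Cox2013, §11.C Thm. 11.18(i),(iii)] -/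
theorem eval_eq_sum (x y : ℂ) :
    (((intModularPolynomial 2).map (mapRingHom (Int.castRingHom ℂ))).map (evalRingHom y)).eval x =
      ∑ m ∈ Finset.range 4, (∑ i ∈ Finset.range 4,
        ((((intModularPolynomial 2).coeff m).coeff i : ℤ) : ℂ) * y ^ i) * x ^ m := by
  have hdeg : (((intModularPolynomial 2).map (mapRingHom (Int.castRingHom ℂ))).map
      (evalRingHom y)).natDegree < 4 :=
    lt_of_le_of_lt (natDegree_map_le.trans (natDegree_map_le.trans natDegree_eq.le)) (by norm_num)
  rw [eval_eq_sum_range' hdeg]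
  refine Finset.sum_congr rfl fun m _ => ?_
  congr 1
  rw [coeff_map, coeff_map, coe_mapRingHom, coe_evalRingHom]
  have hdeg' : (((intModularPolynomial 2).coeff m).map (Int.castRingHom ℂ)).natDegree < 4 :=
    lt_of_le_of_lt (natDegree_map_le.trans (natDegree_coeff_le m)) (by norm_num)
  rw [eval_eq_sum_range' hdeg']
  refine Finset.sum_congr rfl fun i _ => ?_
  rw [coeff_map, eq_intCast]

/-- `Φ₂(x, y) = x³ + (κ₂₀ + κ₂₁y − y²)x² + (κ₁₀ + κ₁₁y + κ₁₂y²)x + (κ₀₀ + κ₀₁y + κ₀₂y² + κ₀₃y³)` over `ℂ`,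
with `κ_{m,i}` the integer coefficient of `X^m Yⁱ`. [cite: Cox2013, §11.C Thm. 11.18] -/
theorem eval_eq_explicit (x y : ℂ) :
    (((intModularPolynomial 2).map (mapRingHom (Int.castRingHom ℂ))).map (evalRingHom y)).eval x =
      x ^ 3 + ((((intModularPolynomial 2).coeff 2).coeff 0 : ℂ) +
          (((intModularPolynomial 2).coeff 2).coeff 1 : ℂ) * y - y ^ 2) * x ^ 2 +
        ((((intModularPolynomial 2).coeff 1).coeff 0 : ℂ) + (((intModularPolynomial 2).coeff 1).coeff 1 : ℂ) * y +
          (((intModularPolynomial 2).coeff 1).coeff 2 : ℂ) * y ^ 2) * x +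
        ((((intModularPolynomial 2).coeff 0).coeff 0 : ℂ) + (((intModularPolynomial 2).coeff 0).coeff 1 : ℂ) * y +
          (((intModularPolynomial 2).coeff 0).coeff 2 : ℂ) * y ^ 2 +
          (((intModularPolynomial 2).coeff 0).coeff 3 : ℂ) * y ^ 3) := by
  rw [eval_eq_sum]
  simp only [Finset.sum_range_succ, Finset.sum_range_zero, coeff_three_coeff, coeff_two_two,
    coeff_two_three, coeff_one_three]
  push_cast
  ring

/-- **The fibre identity**: `Φ₂(x, j(τ)) = (x − j(2τ)) · ((x − j(τ/2)) · (x − j((τ+1)/2)))`.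
[cite: Cox2013, §11.B (11.14)–(11.15)] -/
theorem eval_kleinJ_eq_prod (x : ℂ) (τ : ℍ) :
    (((intModularPolynomial 2).map (mapRingHom (Int.castRingHom ℂ))).map (evalRingHom (kleinJ τ))).eval x =
      (x - kleinJ (mulPoint 2 τ)) * ((x - kleinJ (divPoint 2 0 τ)) * (x - kleinJ (divPoint 2 1 τ))) := by
  rw [map_intModularPolynomial, eval_map_kleinJ_modularPolynomial, Fintype.prod_option]
  have h2 : ∏ k : ZMod 2, (x - jConj (some k) τ) =
      (x - jConj (some (0 : ZMod 2)) τ) * (x - jConj (some (1 : ZMod 2)) τ) :=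
    Fin.prod_univ_two (fun k : ZMod 2 => x - jConj (some k) τ)
  rw [h2, jConj_none, jConj_some_eq_of_intCast_eq (k := (0 : ZMod 2)) (k' := 0) (by simp),
    jConj_some_eq_of_intCast_eq (k := (1 : ZMod 2)) (k' := 1) (by simp)]

/-! ### CM points of level 2 above the class-number-one points `τ_{(1,1,1)}, i, τ_{(1,1,2)}, i√2` -/

/-- Scaling a form by `2` does not move its CM point: `τ_{(2a, 2b, 2c)} = τ_{(a, b, c)}`. [folklore] -/
private theorem heegnerTau_two_mul {a b c : ℤ} (ha : 0 < a) (hD : b ^ 2 - 4 * a * c < 0) :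
    heegnerTau (2 * a, 2 * b, 2 * c) = heegnerTau (a, b, c) := by
  have ha0 : (a : ℂ) ≠ 0 := by exact_mod_cast ha.ne'
  apply UpperHalfPlane.ext
  rw [coe_heegnerTau_eq (Q := (2 * a, 2 * b, 2 * c)) (D := 4 * (b ^ 2 - 4 * a * c)) (by simp only; linarith)
      (by simp only; ring) (by linarith),
    coe_heegnerTau_eq (Q := (a, b, c)) (D := b ^ 2 - 4 * a * c) ha rfl hD, sqrtDisc_four_mul]
  push_cast
  field_simp

/-- `j(τ_{(a,b,c)}) = j(τ_{f·M})` for `M = (0 −1; 1 0)`: `j(τ_{(a, b, c)}) = j(τ_{(c, −b, a)})`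
(`0 < a`, `0 < c`, negative discriminant). [cite: Cox2013, §11.A Thm. 11.2 and Exercise 11.5] -/
theorem formJ_eq_formJ_flip {a b c : ℤ} (ha : 0 < a) (hD : b ^ 2 - 4 * a * c < 0) :
    formJ (a, b, c) = formJ (c, -b, a) := by
  have h := formJ_eq_formJ_act ⟨a, b, c⟩ ha hD (p := 0) (q := -1) (r := 1) (s := 0) (by norm_num)
  simpa [BinQF.act] using h

/-! ### The seven class-number-one values used (Cox §12.C table (12.20)), in `formJ` form -/

/-- `j(τ_P) = singularModulus D` for the principal form of a class-number-one discriminant `D`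
(`formJ_principalForm` and the discharged table facts). [cite: Cox2013, §12.C table (12.20)] -/
private theorem formJ_principalForm_eq_singularModulus {D : ℤ} (hD : D ∈ classNumberOneDiscrs) :
    formJ (principalForm D) = ((singularModulus D : ℚ) : ℂ) := by
  have h : D < 0 ∧ (D % 4 = 0 ∨ D % 4 = 1) := by
    have hD' := hD
    simp only [classNumberOneDiscrs, Finset.mem_insert, Finset.mem_singleton] at hD'
    rcases hD' with rfl | rfl | rfl | rfl | rfl | rfl | rfl | rfl | rfl | rfl | rfl | rfl | rfl <;>
      norm_num
  rw [formJ_principalForm h.1 h.2, j_cmPeriodPair_eq_singularModulus singularModuli_classNumberOne_holds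
    singularModuli_nonmaximalOrders_holds hD]

/-- `j(τ_{(1,1,1)}) = 0` (`D = −3`). [cite: Cox2013, §12.C table (12.20)] -/
private theorem formJ_neg_three : formJ (1, 1, 1) = 0 := by
  have h := formJ_principalForm_eq_singularModulus (D := -3) (by decide)
  rw [show principalForm (-3) = (1, 1, 1) by decide] at h
  rw [h]; norm_num [singularModulus]

/-- `j(τ_{(1,0,1)}) = j(i) = 1728` (`D = −4`). [cite: Cox2013, §12.C table (12.20)] -/
private theorem formJ_neg_four : formJ (1, 0, 1) = 1728 := by
  have h := formJ_principalForm_eq_singularModulus (D := -4) (by decide)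
  rw [show principalForm (-4) = (1, 0, 1) by decide] at h
  rw [h]; norm_num [singularModulus]

/-- `j(τ_{(1,1,2)}) = −3375` (`D = −7`). [cite: Cox2013, §12.C table (12.20)] -/
private theorem formJ_neg_seven : formJ (1, 1, 2) = -3375 := by
  have h := formJ_principalForm_eq_singularModulus (D := -7) (by decide)
  rw [show principalForm (-7) = (1, 1, 2) by decide] at h
  rw [h]; norm_num [singularModulus]

/-- `j(τ_{(1,0,2)}) = j(i√2) = 8000` (`D = −8`). [cite: Cox2013, §12.C table (12.20)] -/
private theorem formJ_neg_eight : formJ (1, 0, 2) = 8000 := by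
  have h := formJ_principalForm_eq_singularModulus (D := -8) (by decide)
  rw [show principalForm (-8) = (1, 0, 2) by decide] at h
  rw [h]; norm_num [singularModulus]

/-- `j(τ_{(1,0,3)}) = j(i√3) = 54000` (`D = −12`). [cite: Cox2013, §12.C table (12.20) and §13.A (13.10)] -/
private theorem formJ_neg_twelve : formJ (1, 0, 3) = 54000 := by
  have h := formJ_principalForm_eq_singularModulus (D := -12) (by decide)
  rw [show principalForm (-12) = (1, 0, 3) by decide] at h
  rw [h]; norm_num [singularModulus]

/-- `j(τ_{(1,0,4)}) = j(2i) = 287496` (`D = −16`). [cite: Cox2013, §12.C table (12.20)] -/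
private theorem formJ_neg_sixteen : formJ (1, 0, 4) = 287496 := by
  have h := formJ_principalForm_eq_singularModulus (D := -16) (by decide)
  rw [show principalForm (-16) = (1, 0, 4) by decide] at h
  rw [h]; norm_num [singularModulus]

/-- `j(τ_{(1,0,7)}) = j(i√7) = 16581375` (`D = −28`). [cite: Cox2013, §12.C table (12.20)] -/
private theorem formJ_neg_twentyEight : formJ (1, 0, 7) = 16581375 := by
  have h := formJ_principalForm_eq_singularModulus (D := -28) (by decide)
  rw [show principalForm (-28) = (1, 0, 7) by decide] at h
  rw [h]; norm_num [singularModulus]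

/-- `j(2τ_{(1,1,1)}) = j(τ_{(1,2,4)}) = j(τ_{(1,0,3)}) = 54000`. [cite: Cox2013, §12.C table (12.20) and §13.A (13.10)] -/
theorem kleinJ_mulPoint_two_one_one_one : kleinJ (mulPoint 2 (heegnerTau (1, 1, 1))) = 54000 := by
  have h := mulPoint_two_heegnerTau (a := 1) (b := 1) (c := 1) one_pos (by norm_num)
  norm_num at h
  rw [h, ← formJ_eq_kleinJ, formJ_one_eq_of_discr_eq (B := 2) (C := 4) (B' := 0) (C' := 3)
    (by norm_num) (by norm_num), formJ_neg_twelve]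

/-- `j(τ_{(1,1,1)}/2) = j(τ_{(4,2,1)}) = j(τ_{(1,−2,4)}) = j(τ_{(1,0,3)}) = 54000`. [cite: Cox2013, §12.C (12.20), §13.A (13.10)] -/
theorem kleinJ_divPoint_two_zero_one_one_one : kleinJ (divPoint 2 0 (heegnerTau (1, 1, 1))) = 54000 := by
  have h := divPoint_two_zero_heegnerTau (a := 1) (b := 1) (c := 1) one_pos (by norm_num)
  norm_num at h
  rw [h, ← formJ_eq_kleinJ, formJ_eq_formJ_flip (a := 4) (b := 2) (c := 1) (by norm_num) (by norm_num),
    formJ_one_eq_of_discr_eq (B := -2) (C := 4) (B' := 0) (C' := 3) (by norm_num) (by norm_num), formJ_neg_twelve]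

/-- `j((τ_{(1,1,1)} + 1)/2) = j(τ_{(4,−2,1)}) = j(τ_{(1,2,4)}) = 54000`. [cite: Cox2013, §12.C (12.20), §13.A (13.10)] -/
theorem kleinJ_divPoint_two_one_one_one_one : kleinJ (divPoint 2 1 (heegnerTau (1, 1, 1))) = 54000 := by
  have h := divPoint_two_heegnerTau (a := 1) (b := 1) (c := 1) one_pos (by norm_num) 1
  norm_num at h
  rw [h, ← formJ_eq_kleinJ, formJ_eq_formJ_flip (a := 4) (b := -2) (c := 1) (by norm_num) (by norm_num)]
  norm_num
  rw [formJ_one_eq_of_discr_eq (B := 2) (C := 4) (B' := 0) (C' := 3) (by norm_num) (by norm_num), formJ_neg_twelve]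

/-- `j(2i) = j(τ_{(1,0,4)}) = 287496`. [cite: Cox2013, §12.C table (12.20)] -/
theorem kleinJ_mulPoint_two_I : kleinJ (mulPoint 2 (heegnerTau (1, 0, 1))) = 287496 := by
  have h := mulPoint_two_heegnerTau (a := 1) (b := 0) (c := 1) one_pos (by norm_num)
  norm_num at h
  rw [h, ← formJ_eq_kleinJ, formJ_neg_sixteen]

/-- `j(i/2) = j(τ_{(4,0,1)}) = j(τ_{(1,0,4)}) = 287496`. [cite: Cox2013, §12.C table (12.20)] -/
theorem kleinJ_divPoint_two_zero_I : kleinJ (divPoint 2 0 (heegnerTau (1, 0, 1))) = 287496 := by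
  have h := divPoint_two_zero_heegnerTau (a := 1) (b := 0) (c := 1) one_pos (by norm_num)
  norm_num at h
  rw [h, ← formJ_eq_kleinJ, formJ_eq_formJ_flip (a := 4) (b := 0) (c := 1) (by norm_num) (by norm_num)]
  norm_num
  rw [formJ_neg_sixteen]

/-- `j((i+1)/2) = j(τ_{(4,−4,2)}) = j(τ_{(2,−2,1)}) = j(τ_{(1,2,2)}) = j(i) = 1728`. [cite: Cox2013, §10.A (`j(i) = 1728`)] -/
theorem kleinJ_divPoint_two_one_I : kleinJ (divPoint 2 1 (heegnerTau (1, 0, 1))) = 1728 := by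
  have h := divPoint_two_heegnerTau (a := 1) (b := 0) (c := 1) one_pos (by norm_num) 1
  norm_num at h
  rw [h, show ((4 : ℤ), (-4 : ℤ), (2 : ℤ)) = (2 * 2, 2 * (-2), 2 * 1) by norm_num,
    heegnerTau_two_mul (by norm_num) (by norm_num), ← formJ_eq_kleinJ,
    formJ_eq_formJ_flip (a := 2) (b := -2) (c := 1) (by norm_num) (by norm_num)]
  norm_num
  rw [formJ_one_eq_of_discr_eq (B := 2) (C := 2) (B' := 0) (C' := 1) (by norm_num) (by norm_num), formJ_neg_four]

/-- `j(2τ_{(1,1,2)}) = j(τ_{(1,2,8)}) = j(τ_{(1,0,7)}) = 16581375`. [cite: Cox2013, §12.C table (12.20)] -/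
theorem kleinJ_mulPoint_two_one_one_two : kleinJ (mulPoint 2 (heegnerTau (1, 1, 2))) = 16581375 := by
  have h := mulPoint_two_heegnerTau (a := 1) (b := 1) (c := 2) one_pos (by norm_num)
  norm_num at h
  rw [h, ← formJ_eq_kleinJ, formJ_one_eq_of_discr_eq (B := 2) (C := 8) (B' := 0) (C' := 7)
    (by norm_num) (by norm_num), formJ_neg_twentyEight]

/-- `j(τ_{(1,1,2)}/2) = j(τ_{(4,2,2)}) = j(τ_{(2,1,1)}) = j(τ_{(1,−1,2)}) = j(τ_{(1,1,2)}) = −3375`. [cite: Cox2013, §12.C table (12.20)] -/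
theorem kleinJ_divPoint_two_zero_one_one_two : kleinJ (divPoint 2 0 (heegnerTau (1, 1, 2))) = -3375 := by
  have h := divPoint_two_zero_heegnerTau (a := 1) (b := 1) (c := 2) one_pos (by norm_num)
  norm_num at h
  rw [h, show ((4 : ℤ), (2 : ℤ), (2 : ℤ)) = (2 * 2, 2 * 1, 2 * 1) by norm_num,
    heegnerTau_two_mul (by norm_num) (by norm_num), ← formJ_eq_kleinJ,
    formJ_eq_formJ_flip (a := 2) (b := 1) (c := 1) (by norm_num) (by norm_num),
    formJ_one_eq_of_discr_eq (B := -1) (C := 2) (B' := 1) (C' := 2) (by norm_num) (by norm_num), formJ_neg_seven]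

/-- `j((τ_{(1,1,2)} + 1)/2) = j(τ_{(4,−2,2)}) = j(τ_{(2,−1,1)}) = j(τ_{(1,1,2)}) = −3375`. [cite: Cox2013, §12.C table (12.20)] -/
theorem kleinJ_divPoint_two_one_one_one_two : kleinJ (divPoint 2 1 (heegnerTau (1, 1, 2))) = -3375 := by
  have h := divPoint_two_heegnerTau (a := 1) (b := 1) (c := 2) one_pos (by norm_num) 1
  norm_num at h
  rw [h, show ((4 : ℤ), (-2 : ℤ), (2 : ℤ)) = (2 * 2, 2 * (-1), 2 * 1) by norm_num,
    heegnerTau_two_mul (by norm_num) (by norm_num), ← formJ_eq_kleinJ,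
    formJ_eq_formJ_flip (a := 2) (b := -1) (c := 1) (by norm_num) (by norm_num)]
  norm_num
  rw [formJ_neg_seven]

/-- `j(i√2/2) = j(τ_{(4,0,2)}) = j(τ_{(2,0,1)}) = j(τ_{(1,0,2)}) = j(i√2) = 8000`: the diagonal point
`(8000, 8000)` of `Φ₂ = 0` (Cox Prop. 13.11, `m = 2`: `H_{−8} ∣ Φ₂(X, X)`). [cite: Cox2013, §13.A Prop. 13.11] -/
theorem kleinJ_divPoint_two_zero_sqrt_neg_two : kleinJ (divPoint 2 0 (heegnerTau (1, 0, 2))) = 8000 := by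
  have h := divPoint_two_zero_heegnerTau (a := 1) (b := 0) (c := 2) one_pos (by norm_num)
  norm_num at h
  rw [h, show ((4 : ℤ), (0 : ℤ), (2 : ℤ)) = (2 * 2, 2 * 0, 2 * 1) by norm_num,
    heegnerTau_two_mul (by norm_num) (by norm_num), ← formJ_eq_kleinJ,
    formJ_eq_formJ_flip (a := 2) (b := 0) (c := 1) (by norm_num) (by norm_num)]
  norm_num
  rw [formJ_neg_eight]

/-! ### The three fibres and the diagonal point -/

/-- `Φ₂(x, 0) = (x − 54000)³` (fibre over `j(τ_{(1,1,1)}) = 0`). [cite: Cox2013, §13.A (13.10) and Prop. 13.11] -/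
theorem fiber_zero (x : ℂ) :
    (((intModularPolynomial 2).map (mapRingHom (Int.castRingHom ℂ))).map (evalRingHom 0)).eval x =
      (x - 54000) * ((x - 54000) * (x - 54000)) := by
  have e : kleinJ (heegnerTau (1, 1, 1)) = 0 := by rw [← formJ_eq_kleinJ, formJ_neg_three]
  have h := eval_kleinJ_eq_prod x (heegnerTau (1, 1, 1))
  rwa [e, kleinJ_mulPoint_two_one_one_one, kleinJ_divPoint_two_zero_one_one_one,
    kleinJ_divPoint_two_one_one_one_one] at h

/-- `Φ₂(x, 1728) = (x − 287496)(x − 287496)(x − 1728)` (fibre over `j(i) = 1728`). [cite: Cox2013, §13.A Prop. 13.11] -/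
theorem fiber_1728 (x : ℂ) :
    (((intModularPolynomial 2).map (mapRingHom (Int.castRingHom ℂ))).map (evalRingHom 1728)).eval x =
      (x - 287496) * ((x - 287496) * (x - 1728)) := by
  have e : kleinJ (heegnerTau (1, 0, 1)) = 1728 := by rw [← formJ_eq_kleinJ, formJ_neg_four]
  have h := eval_kleinJ_eq_prod x (heegnerTau (1, 0, 1))
  rwa [e, kleinJ_mulPoint_two_I, kleinJ_divPoint_two_zero_I, kleinJ_divPoint_two_one_I] at h

/-- `Φ₂(x, −3375) = (x − 16581375)(x + 3375)(x + 3375)` (fibre over `j(τ_{(1,1,2)}) = −3375`). [cite: Cox2013, §13.A Prop. 13.11] -/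
theorem fiber_neg_3375 (x : ℂ) :
    (((intModularPolynomial 2).map (mapRingHom (Int.castRingHom ℂ))).map (evalRingHom (-3375))).eval x =
      (x - 16581375) * ((x - -3375) * (x - -3375)) := by
  have e : kleinJ (heegnerTau (1, 1, 2)) = -3375 := by rw [← formJ_eq_kleinJ, formJ_neg_seven]
  have h := eval_kleinJ_eq_prod x (heegnerTau (1, 1, 2))
  rwa [e, kleinJ_mulPoint_two_one_one_two, kleinJ_divPoint_two_zero_one_one_two,
    kleinJ_divPoint_two_one_one_one_two] at h

/-- `Φ₂(8000, 8000) = 0` (`j(i√2/2) = j(i√2) = 8000`). [cite: Cox2013, §13.A Prop. 13.11] -/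
theorem diag_8000 :
    (((intModularPolynomial 2).map (mapRingHom (Int.castRingHom ℂ))).map (evalRingHom 8000)).eval 8000 = 0 := by
  have e : kleinJ (heegnerTau (1, 0, 2)) = 8000 := by rw [← formJ_eq_kleinJ, formJ_neg_eight]
  have h := eval_kleinJ_eq_prod 8000 (heegnerTau (1, 0, 2))
  rw [e, kleinJ_divPoint_two_zero_sqrt_neg_two, sub_self, zero_mul, mul_zero] at h
  exact h

/-! ### Solving for the nine coefficients -/

section Solve

/-- The ten linear equations, solved (unknowns cast to `ℂ`). [folklore] -/
private theorem eqs :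
    let A0 : ℂ := ((intModularPolynomial 2).coeff 2).coeff 0
    let A1 : ℂ := ((intModularPolynomial 2).coeff 2).coeff 1
    let B0 : ℂ := ((intModularPolynomial 2).coeff 1).coeff 0
    let B1 : ℂ := ((intModularPolynomial 2).coeff 1).coeff 1
    let B2 : ℂ := ((intModularPolynomial 2).coeff 1).coeff 2
    let D0 : ℂ := ((intModularPolynomial 2).coeff 0).coeff 0
    let D1 : ℂ := ((intModularPolynomial 2).coeff 0).coeff 1
    let D2 : ℂ := ((intModularPolynomial 2).coeff 0).coeff 2
    let D3 : ℂ := ((intModularPolynomial 2).coeff 0).coeff 3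
    A0 = -162000 ∧ A1 = 1488 ∧ B0 = 8748000000 ∧ B1 = 40773375 ∧ B2 = 1488 ∧
      D0 = -157464000000000 ∧ D1 = 8748000000 ∧ D2 = -162000 ∧ D3 = 1 := by
  intro A0 A1 B0 B1 B2 D0 D1 D2 D3
  have h_0_0 := fiber_zero 0
  have h_0_1 := fiber_zero 1
  have h_0_m1 := fiber_zero (-1)
  have h_1728_0 := fiber_1728 0
  have h_1728_1 := fiber_1728 1
  have h_1728_m1 := fiber_1728 (-1)
  have h_m3375_0 := fiber_neg_3375 0
  have h_m3375_1 := fiber_neg_3375 1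
  have h_diag := diag_8000
  rw [eval_eq_explicit] at h_0_0 h_0_1 h_0_m1 h_1728_0 h_1728_1 h_1728_m1 h_m3375_0 h_m3375_1 h_diag
  refine ⟨?_, ?_, ?_, ?_, ?_, ?_, ?_, ?_, ?_⟩
  · linear_combination (-1 : ℂ) * h_0_0 + ((1 / 2) : ℂ) * h_0_1 + ((1 / 2) : ℂ) * h_0_m1
  · linear_combination ((1 / 1728) : ℂ) * h_0_0 + ((-1 / 3456) : ℂ) * h_0_1 + ((-1 / 3456) : ℂ) * h_0_m1 +
      ((-1 / 1728) : ℂ) * h_1728_0 + ((1 / 3456) : ℂ) * h_1728_1 + ((1 / 3456) : ℂ) * h_1728_m1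
  · linear_combination ((1 / 2) : ℂ) * h_0_1 + ((-1 / 2) : ℂ) * h_0_m1
  · linear_combination ((-1 / 3375) : ℂ) * h_0_0 + ((1 / 144000) : ℂ) * h_0_1 + ((1 / 3456) : ℂ) * h_0_m1 +
      ((1 / 5103) : ℂ) * h_1728_0 + ((61 / 653184) : ℂ) * h_1728_1 + ((-1 / 3456) : ℂ) * h_1728_m1 +
      ((64 / 637875) : ℂ) * h_m3375_0 + ((-64 / 637875) : ℂ) * h_m3375_1
  · linear_combination ((1 / 5832000) : ℂ) * h_0_0 + ((-1 / 5832000) : ℂ) * h_0_1 +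
      ((-1 / 8817984) : ℂ) * h_1728_0 + ((1 / 8817984) : ℂ) * h_1728_1 + ((-1 / 17222625) : ℂ) * h_m3375_0 +
      ((1 / 17222625) : ℂ) * h_m3375_1
  · linear_combination (1 : ℂ) * h_0_0
  · linear_combination ((5833726999 / 2457000) : ℂ) * h_0_0 + ((-216155 / 182) : ℂ) * h_0_1 +
      ((-215973 / 182) : ℂ) * h_0_m1 + ((-179986476125 / 59439744) : ℂ) * h_1728_0 +
      ((104187875 / 68796) : ℂ) * h_1728_1 + ((26996625 / 17836) : ℂ) * h_1728_m1 +
      ((-13828096 / 58046625) : ℂ) * h_m3375_0 + ((4096 / 17199) : ℂ) * h_m3375_1 +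
      ((-729 / 71344000) : ℂ) * h_diag
  · linear_combination ((-2846859842123 / 4245696000000) : ℂ) * h_0_0 + ((2637091 / 7862400) : ℂ) * h_0_1 +
      ((487939 / 1456000) : ℂ) * h_0_m1 + ((87833423099 / 102711877632) : ℂ) * h_1728_0 +
      ((-50843683 / 118879488) : ℂ) * h_1728_1 + ((-487939 / 1141504) : ℂ) * h_1728_m1 +
      ((13185728 / 195907359375) : ℂ) * h_m3375_0 + ((-3904 / 58046625) : ℂ) * h_m3375_1 +
      ((1647 / 570752000000) : ℂ) * h_diag
  · linear_combination ((-1728511909 / 4245696000000) : ℂ) * h_0_0 + ((43231 / 212284800) : ℂ) * h_0_1 +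
      ((7999 / 39312000) : ℂ) * h_0_m1 + ((53329333 / 102711877632) : ℂ) * h_1728_0 +
      ((-833503 / 3209746176) : ℂ) * h_1728_1 + ((-7999 / 30820608) : ℂ) * h_1728_m1 +
      ((7999 / 195907359375) : ℂ) * h_m3375_0 + ((-64 / 1567258875) : ℂ) * h_m3375_1 +
      ((1 / 570752000000) : ℂ) * h_diag

/-- The nine integer coefficients. [cite: Cox2013, §11.C Thm. 11.18 and §13.A Prop. 13.11] -/
theorem coeffs :
    ((intModularPolynomial 2).coeff 2).coeff 0 = -162000 ∧ ((intModularPolynomial 2).coeff 2).coeff 1 = 1488 ∧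
    ((intModularPolynomial 2).coeff 1).coeff 0 = 8748000000 ∧ ((intModularPolynomial 2).coeff 1).coeff 1 = 40773375 ∧
    ((intModularPolynomial 2).coeff 1).coeff 2 = 1488 ∧
    ((intModularPolynomial 2).coeff 0).coeff 0 = -157464000000000 ∧
    ((intModularPolynomial 2).coeff 0).coeff 1 = 8748000000 ∧ ((intModularPolynomial 2).coeff 0).coeff 2 = -162000 ∧
    ((intModularPolynomial 2).coeff 0).coeff 3 = 1 := by
  obtain ⟨h1, h2, h3, h4, h5, h6, h7, h8, h9⟩ := eqs
  refine ⟨?_, ?_, ?_, ?_, ?_, ?_, ?_, ?_, ?_⟩ <;> apply (Int.cast_injective (α := ℂ)) <;> push_cast <;>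
    assumption

end Solve

end ModularPolynomialTwo

/-- Two polynomials of `ℤ[Y][X]` with the same values on `ℂ × ℂ` are equal. [folklore] -/
private theorem ModularPolynomialTwo.eq_of_eval_eq {P Q : Polynomial (Polynomial ℤ)}
    (h : ∀ x y : ℂ, ((P.map (mapRingHom (Int.castRingHom ℂ))).map (evalRingHom y)).eval x =
      ((Q.map (mapRingHom (Int.castRingHom ℂ))).map (evalRingHom y)).eval x) : P = Q := by
  have hinj : Function.Injective (mapRingHom (Int.castRingHom ℂ) : Polynomial ℤ →+* Polynomial ℂ) :=
    fun a b hab => Polynomial.map_injective _ (RingHom.injective_int _) hab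
  apply Polynomial.map_injective _ hinj
  refine Polynomial.ext fun m => Polynomial.funext fun y => ?_
  have hPQ : (P.map (mapRingHom (Int.castRingHom ℂ))).map (evalRingHom y) =
      (Q.map (mapRingHom (Int.castRingHom ℂ))).map (evalRingHom y) :=
    Polynomial.funext fun x => h x y
  have hm := congr_arg (fun R : Polynomial ℂ => R.coeff m) hPQ
  simpa only [coeff_map, coe_evalRingHom] using hm

open ModularPolynomialTwo in
/-- **`Φ₂(x, y)` explicitly, for all complex `x, y`.** [cite: Pila2022, p. 28] [cite: Cox2013, §11.C Thm. 11.18; §13.A Prop. 13.11] -/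
theorem intModularPolynomial_two_eval (x y : ℂ) :
    (((intModularPolynomial 2).map (mapRingHom (Int.castRingHom ℂ))).map (evalRingHom y)).eval x =
      x ^ 3 + y ^ 3 - x ^ 2 * y ^ 2 + 1488 * (x ^ 2 * y + x * y ^ 2) - 162000 * (x ^ 2 + y ^ 2) +
        40773375 * x * y + 8748000000 * (x + y) - 157464000000000 := by
  obtain ⟨h20, h21, h10, h11, h12, h00, h01, h02, h03⟩ := coeffs
  rw [eval_eq_explicit, h20, h21, h10, h11, h12, h00, h01, h02, h03]
  push_cast
  ring

open ModularPolynomialTwo in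
/-- **The modular equation of level 2** in `ℤ[Y][X]` (outer variable `X`, inner variable written `X`
inside `C (…)` = `Y`):
`Φ₂ = X³ + (−Y² + 1488Y − 162000)X² + (1488Y² + 40773375Y + 8748000000)X + (Y³ − 162000Y² + 8748000000Y − 157464000000000)`.
[cite: Pila2022, p. 28 (display `Φ₂(X, Y)`)] [cite: Cox2013, §11.C Thm. 11.18 and §13.A Prop. 13.11 (m = 2)] -/
theorem intModularPolynomial_two :
    intModularPolynomial 2 =
      X ^ 3 + C (-X ^ 2 + C 1488 * X - C 162000) * X ^ 2 +
        C (C 1488 * X ^ 2 + C 40773375 * X + C 8748000000) * X +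
        C (X ^ 3 - C 162000 * X ^ 2 + C 8748000000 * X - C 157464000000000) := by
  refine eq_of_eval_eq fun x y => ?_
  rw [intModularPolynomial_two_eval]
  simp only [Polynomial.map_add, Polynomial.map_sub, Polynomial.map_neg, Polynomial.map_mul,
    Polynomial.map_pow, map_X, map_C, coe_mapRingHom, eval_add, eval_sub, eval_neg, eval_mul, eval_pow,
    eval_X, eval_C, coe_evalRingHom, map_ofNat, Polynomial.map_ofNat, Polynomial.eval_ofNat]
  ring

open ModularPolynomialTwo in
/-- **The level-2 modular equation at a point of `ℍ`**: for every `τ`,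
`j(2τ)³ + j(τ)³ − j(2τ)²j(τ)² + 1488(j(2τ)²j(τ) + j(2τ)j(τ)²) − 162000(j(2τ)² + j(τ)²) + 40773375 j(2τ)j(τ)`
`+ 8748000000(j(2τ) + j(τ)) − 157464000000000 = 0` ("`Φ₂(j(z), j(2z)) = 0`").
[cite: Pila2022, p. 28] [cite: Cox2013, §11.B after (11.15)] -/
theorem modularEquation_two_kleinJ (τ : ℍ) :
    kleinJ (mulPoint 2 τ) ^ 3 + kleinJ τ ^ 3 - kleinJ (mulPoint 2 τ) ^ 2 * kleinJ τ ^ 2 +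
      1488 * (kleinJ (mulPoint 2 τ) ^ 2 * kleinJ τ + kleinJ (mulPoint 2 τ) * kleinJ τ ^ 2) -
      162000 * (kleinJ (mulPoint 2 τ) ^ 2 + kleinJ τ ^ 2) + 40773375 * kleinJ (mulPoint 2 τ) * kleinJ τ +
      8748000000 * (kleinJ (mulPoint 2 τ) + kleinJ τ) - 157464000000000 = 0 := by
  rw [← intModularPolynomial_two_eval, eval_kleinJ_eq_prod]
  ring

/-- The same at `(j((τ + k)/2), j(τ))`. [cite: Cox2013, §11.B (11.15)] -/
theorem modularEquation_two_kleinJ_divPoint (k : ℤ) (τ : ℍ) :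
    kleinJ (divPoint 2 k τ) ^ 3 + kleinJ τ ^ 3 - kleinJ (divPoint 2 k τ) ^ 2 * kleinJ τ ^ 2 +
      1488 * (kleinJ (divPoint 2 k τ) ^ 2 * kleinJ τ + kleinJ (divPoint 2 k τ) * kleinJ τ ^ 2) -
      162000 * (kleinJ (divPoint 2 k τ) ^ 2 + kleinJ τ ^ 2) + 40773375 * kleinJ (divPoint 2 k τ) * kleinJ τ +
      8748000000 * (kleinJ (divPoint 2 k τ) + kleinJ τ) - 157464000000000 = 0 := by
  rw [← intModularPolynomial_two_eval]
  exact intModularPolynomial_kleinJ_divPoint 2 k τ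

end Literature.NumberTheory.EllipticCurves
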